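import Literature.Computability.Cryptography.BranchingProgramEncoding
import Literature.Computability.Complexity.PolynomialEntropyApproximation
import HarnessLib

/-!
# Entropy Approximation and Entropy Difference for branching-program samplers (`PEABP`, `PEDBP`)

The entropy problems of Goldreich–Sahai–Vadhan / Goldreich–Vadhan (`EA`, `ED`) restricted to maps
`f : {0,1}ⁿ → {0,1}^ℓ` whose output bits are computed by DETERMINISTIC BRANCHING PROGRAMS, the
representation through which Dvir–Gutfreund–Rothblum–Vadhan route every logarithmic-space sampler
into degree-3 polynomial maps [DGRV 2010, §4.2, Thm 4.5–4.6: a branching program of size `s` has a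
perfect randomized encoding of degree `3` over `F₂`, so the entropy difference problem for
branching-program samplers Karp-reduces to `PED_{F₂,3}`; §4.3, Thm 4.7: hence `PED_{F₂,3}` and
`PEA_{F₂,3}` are complete for `SZKP_L`; the same representation is the `EA_BP` / `ED_BP` of
Allender–Gray–Mutreja–Tirumala–Wang 2025, §2].

* `RawBPNode = ℕ × ℕ × ℕ × ℕ`, `RawBP = List RawBPNode` — the INSTANCE FORMAT: node `i` of a program
  is its `i`-th entry `(tag, x, lo, hi)`; `tag = 0` a `0`-sink, `tag = 1` a `1`-sink, `tag ≥ 2` a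
  decision node testing variable `x` with `0`-successor `lo` and `1`-successor `hi`; a program is
  VALID for `n` variables (`RawBP.Valid`, decidable) when it is non-empty and every decision node
  `i` has `x < n`, `lo < i`, `hi < i` (the topological order of the tree's `BDD`,
  `BinaryDecisionDiagrams.lean`); its root is the LAST node.  `RawBP.compile n B : Σ s, BDD (Fin n) s`
  is the typed program (`RawBP.toBDD`) of a valid `B` and the one-node `0`-sink otherwise, so that
  every string of the format denotes a sampler (no validity promise is needed).
* `bpMap n Bs : F₂ⁿ → List Bool` — the map computed by the programs `Bs` (one output bit each, via
  the tree's `fnList` / `toInput` of `BranchingProgramEncoding.lean`), `bpEntropy n Bs = H(bpMap(U_n))`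
  (Shannon entropy in bits of the output on a uniform input, `mapEntropy`).
* `PEABPInst = ℕ × List RawBP × ℕ` (variables `n` in binary, programs, threshold `k` in binary),
  `PEABPInst.encoding`, `PEABP` (YES `H ≥ k + 1`, NO `H ≤ k` — the gap convention of the tree's
  `PEA d`); `PEDBPInst`, `PEDBPInst.encoding`, `PEDBP` (YES `H(p) ≥ H(q) + 1`, NO `H(p) + 1 ≤ H(q)` —
  the convention of the tree's `PED d`); unfolding lemmas, disjointness, `bpEntropy_le_length`.
* `PEABPInst.toPEA` — the instance map of DGRV Thm 4.6 on the `PEA` side,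
  `(n, Bs, k) ↦ (n + m, encodeBDDsMap n (compile Bs), k + m)` with `m` the number of random bits of
  the tree's AIK encoding, and its correctness `toPEA_mem_yes` / `toPEA_mem_no` (YES ↦ YES of
  `PEA 3`, NO ↦ NO), from `entropy_encodeBDDsMap` (`H = H(f) + m`) and `degLE_three_encodeBDDsMap`.
  The polynomial-time clause (a `CodeFP` program for `toPEA` on codes) and the converse reduction
  `PEA d ≤ₚ PEABP` (parity branching programs of sparse polynomials) are separate files.

## Design notes

* Raw naturals rather than a dependent encoding of the structure `BDD X s` (which carries an
  acyclicity proof): the Boolean code is the plain tuple code `pairBool`/`listBool`/`encodingNatBool`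
  of the tree, and the typed program is recovered by `compile`; invalid strings are harmless
  constant samplers.  This is the format the `CodeFP` kit reads (`natE`, `pairE`, `listE`).
* One output bit per program (as in DGRV §4.2 and `encodeBDDsMap`); multi-output programs are lists.
* Not here: nondeterministic / parity (mod-2) branching programs (AIK Lemma 4.15 in full
  generality; the tree's encoding is the deterministic case), the classes `SZKP_L` / `NISZK_L`.

## References

* Z. Dvir, D. Gutfreund, G. N. Rothblum, S. Vadhan, *On approximating the entropy of polynomial
  mappings*, ECCC TR10-160 (2010) / ICS 2011, §4.2 (Thm 4.5, Thm 4.6), §4.3 (Thm 4.7), Claim 4.4.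
  bib `DvirGutfreundRothblumVadhan2010`.
* E. Allender, J. Gray, S. Mutreja, H. Tirumala, P. Wang, *Robustness for space-bounded
  statistical zero knowledge*, 2025, §2 (`EA_BP`, `ED_BP`), Lemma 10.
* O. Goldreich, A. Sahai, S. Vadhan, CRYPTO 1999 (`EA`); O. Goldreich, S. Vadhan, CCC 1999 (`ED`).
-/

namespace Literature.Computability.Complexity

open _root_.Computability Literature.InformationTheory.Entropy Finset
open Literature.Computability.Cryptography (toInput fnList freshBDDs encodeBDDsMap
  entropy_encodeBDDsMap degLE_three_encodeBDDsMap)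

/-! ### Raw branching programs -/

/-- A raw node `(tag, x, lo, hi)`: `tag = 0` the `0`-sink, `tag = 1` the `1`-sink, `tag ≥ 2` a
decision node testing variable `x` with `0`-successor `lo` and `1`-successor `hi` (node indices).
[DGRV 2010, §4.2 (branching programs); Wegener 2000, Def. 1.1] [cite: DvirGutfreundRothblumVadhan2010, §4.2] -/
abbrev RawBPNode : Type := ℕ × ℕ × ℕ × ℕ

/-- A raw deterministic branching program: the list of its nodes, node `i` the `i`-th entry, in
topological order (successors have smaller index), root the last node.
[DGRV 2010, §4.2; Wegener 2000, Def. 1.1] [cite: DvirGutfreundRothblumVadhan2010, §4.2] -/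
abbrev RawBP : Type := List RawBPNode

namespace RawBP

/-- Well-formedness of the node at position `i` of a program over `n` variables: a decision node
(`tag ≥ 2`) tests a variable `< n` and points to earlier nodes. [folklore] -/
def nodeOK (n i : ℕ) (nd : RawBPNode) : Bool :=
  decide (nd.1 < 2) || (decide (nd.2.1 < n) && decide (nd.2.2.1 < i) && decide (nd.2.2.2 < i))

/-- A raw program is VALID for `n` variables: non-empty and every node well-formed at its
position. [folklore] -/
def Valid (n : ℕ) (B : RawBP) : Prop :=
  0 < B.length ∧ ∀ i : Fin B.length, nodeOK n i.val B[i] = true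

/-- Validity is decidable (a finite conjunction of numeral comparisons). [folklore] -/
instance (n : ℕ) (B : RawBP) : Decidable (Valid n B) := by
  unfold Valid; infer_instance

/-- A well-formed decision node has its data in range. [folklore] -/
theorem nodeOK_branch {n i : ℕ} {nd : RawBPNode} (h : nodeOK n i nd = true) (h2 : 2 ≤ nd.1) :
    nd.2.1 < n ∧ nd.2.2.1 < i ∧ nd.2.2.2 < i := by
  simp only [nodeOK, Bool.or_eq_true, decide_eq_true_eq, Bool.and_eq_true] at h
  omega

/-- The typed node at position `i` of a valid raw program. [folklore] -/
def nodeOf (n : ℕ) (B : RawBP) (h : Valid n B) (i : Fin B.length) : BDD.Node (Fin n) B.length :=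
  if h2 : 2 ≤ (B[i]).1 then
    .branch ⟨(B[i]).2.1, (nodeOK_branch (h.2 i) h2).1⟩
      ⟨(B[i]).2.2.1, lt_trans (nodeOK_branch (h.2 i) h2).2.1 i.isLt⟩
      ⟨(B[i]).2.2.2, lt_trans (nodeOK_branch (h.2 i) h2).2.2 i.isLt⟩
  else .leaf (decide ((B[i]).1 = 1))

/-- Successors of typed nodes are earlier. [folklore] -/
theorem lt_of_mem_children_nodeOf (n : ℕ) (B : RawBP) (h : Valid n B) (i : Fin B.length) :
    ∀ j ∈ (nodeOf n B h i).children, j < i := by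
  intro j hj
  unfold nodeOf at hj
  split_ifs at hj with h2
  · have hb := nodeOK_branch (h.2 i) h2
    simp only [BDD.Node.children, List.mem_cons, List.not_mem_nil, or_false] at hj
    rcases hj with rfl | rfl
    · exact Fin.mk_lt_of_lt_val hb.2.1
    · exact Fin.mk_lt_of_lt_val hb.2.2
  · simp [BDD.Node.children] at hj

/-- **The typed branching program of a valid raw program** (the tree's `BDD` over the variables
`Fin n`, `s = |B|` nodes, root the last node). [DGRV 2010, §4.2] [cite: DvirGutfreundRothblumVadhan2010, §4.2] -/
def toBDD (n : ℕ) (B : RawBP) (h : Valid n B) : BDD (Fin n) B.length where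
  node := nodeOf n B h
  lt_of_mem_children := lt_of_mem_children_nodeOf n B h
  root := ⟨B.length - 1, Nat.sub_lt h.1 Nat.one_pos⟩

/-- The one-node program computing the constant `false`. [folklore] -/
def falseBDD (X : Type) : BDD X 1 where
  node := fun _ => .leaf false
  lt_of_mem_children := fun i j hj => by simp [BDD.Node.children] at hj
  root := 0

/-- The constant-`false` program computes `false`. [folklore] -/
@[simp] theorem falseBDD_fn (X : Type) (z : X → Bool) : (falseBDD X).fn z = false :=
  BDD.eval_of_leaf rfl

/-- **Compilation**: a valid raw program denotes its typed program, an invalid one the constant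
`false` (so every raw program denotes a sampler). [folklore] -/
def compile (n : ℕ) (B : RawBP) : Σ s, BDD (Fin n) s :=
  if h : Valid n B then ⟨B.length, toBDD n B h⟩ else ⟨1, falseBDD (Fin n)⟩

/-- Compilation of a valid program. [folklore] -/
theorem compile_of_valid {n : ℕ} {B : RawBP} (h : Valid n B) :
    compile n B = ⟨B.length, toBDD n B h⟩ := by
  simp [compile, h]

/-- Compilation of an invalid program. [folklore] -/
theorem compile_of_not_valid {n : ℕ} {B : RawBP} (h : ¬ Valid n B) :
    compile n B = ⟨1, falseBDD (Fin n)⟩ := by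
  simp [compile, h]

/-- The size of the compiled program: `|B|` if valid, `1` otherwise — at most `max |B| 1`.
[folklore] -/
theorem compile_fst_le (n : ℕ) (B : RawBP) : (compile n B).1 ≤ max B.length 1 := by
  by_cases h : Valid n B
  · rw [compile_of_valid h]; exact le_max_left _ _
  · rw [compile_of_not_valid h]; exact le_max_right _ _

end RawBP

/-! ### The sampler of a list of programs and its entropy -/

/-- The typed programs of a list of raw programs over `n` variables. [folklore] -/
def compileAll (n : ℕ) (Bs : List RawBP) : List (Σ s, BDD (Fin n) s) :=
  Bs.map (RawBP.compile n)

/-- The number of programs is preserved. [folklore] -/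
@[simp] theorem length_compileAll (n : ℕ) (Bs : List RawBP) : (compileAll n Bs).length = Bs.length := by
  simp [compileAll]

/-- **The map `F₂ⁿ → {0,1}^ℓ` sampled by a list of `ℓ` branching programs** (output bit `j` =
the bit computed by program `j` on the input read as a Boolean assignment).
[DGRV 2010, §4.2] [cite: DvirGutfreundRothblumVadhan2010, §4.2] -/
def bpMap (n : ℕ) (Bs : List RawBP) : (Fin n → ZMod 2) → List Bool :=
  fun x => fnList (compileAll n Bs) (toInput x)

/-- Every output has `ℓ = |Bs|` bits. [folklore] -/
@[simp] theorem length_bpMap (n : ℕ) (Bs : List RawBP) (x : Fin n → ZMod 2) :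
    (bpMap n Bs x).length = Bs.length := by
  simp [bpMap, fnList, compileAll]

/-- **The output entropy `H(f(U_n))` in bits of a branching-program sampler** on a uniform input.
[DGRV 2010, §2 Def 2.1 and §4.2] [cite: DvirGutfreundRothblumVadhan2010, §4.2] -/
noncomputable def bpEntropy (n : ℕ) (Bs : List RawBP) : ℝ :=
  mapEntropy (Finset.univ : Finset (Fin n → ZMod 2)) (bpMap n Bs)

/-- The output entropy is non-negative. [Cover–Thomas, 2nd ed., Lemma 2.1.1] [folklore] -/
theorem bpEntropy_nonneg (n : ℕ) (Bs : List RawBP) : 0 ≤ bpEntropy n Bs :=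
  mapEntropy_nonneg _ _

/-- **`H(f(U_n)) ≤ ℓ`**: the output entropy of `ℓ` programs is at most `ℓ` bits (at most `2^ℓ`
outputs). [Cover–Thomas, 2nd ed., Thm 2.6.4] [folklore] -/
theorem bpEntropy_le_length (n : ℕ) (Bs : List RawBP) : bpEntropy n Bs ≤ Bs.length := by
  classical
  have hS : (Finset.univ : Finset (Fin n → ZMod 2)).Nonempty := Finset.univ_nonempty
  have hbound : ∀ z : Unit, (((Finset.univ : Finset (Fin n → ZMod 2)).image (bpMap n Bs)).filter
      fun y => (fun _ : List Bool => ()) y = z).card ≤ 2 ^ Bs.length := by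
    intro z
    calc (((Finset.univ : Finset (Fin n → ZMod 2)).image (bpMap n Bs)).filter
            fun y => (fun _ : List Bool => ()) y = z).card
        ≤ ((Finset.univ : Finset (List.Vector Bool Bs.length)).image
            (fun v => v.toList)).card := by
          refine Finset.card_le_card fun y hy => ?_
          rw [Finset.mem_filter, Finset.mem_image] at hy
          obtain ⟨⟨x, -, rfl⟩, -⟩ := hy
          exact Finset.mem_image.2 ⟨⟨bpMap n Bs x, length_bpMap n Bs x⟩, Finset.mem_univ _, rfl⟩
      _ ≤ (Finset.univ : Finset (List.Vector Bool Bs.length)).card := Finset.card_image_le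
      _ = 2 ^ Bs.length := by rw [Finset.card_univ, card_vector, Fintype.card_bool]
  have h := mapEntropy_sub_le_mapEntropy_comp hS (bpMap n Bs) (fun _ : List Bool => ()) Bs.length
    hbound
  have h0 : mapEntropy (Finset.univ : Finset (Fin n → ZMod 2)) ((fun _ : List Bool => ()) ∘ bpMap n Bs)
      = 0 := mapEntropy_const _ ()
  unfold bpEntropy
  linarith

/-! ### The promise problems -/

/-- The Boolean code of a raw node: the tuple code of four binary numerals.
[Arora–Barak 2009, §0.1] [cite: AroraBarak2009, §0.1] -/
def RawBPNode.encoding : Encoding RawBPNode Bool :=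
  encodingNatBool.pairBool (encodingNatBool.pairBool (encodingNatBool.pairBool encodingNatBool))

/-- The Boolean code of a raw program: the headed list of its node codes.
[Arora–Barak 2009, §0.1] [cite: AroraBarak2009, §0.1] -/
def RawBP.encoding : Encoding RawBP Bool :=
  RawBPNode.encoding.listBool

/-- Instances of `PEABP`: the number of variables `n`, the programs, the threshold `k`.
[DGRV 2010, §3 p. 6 (`EA`-type instances) and §4.2] [cite: DvirGutfreundRothblumVadhan2010, §4.2] -/
abbrev PEABPInst : Type := ℕ × List RawBP × ℕ

/-- The Boolean code of `PEABP` instances: `n` in binary, the headed list of program codes, `k`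
in binary. [Arora–Barak 2009, §0.1] [cite: AroraBarak2009, §0.1] -/
def PEABPInst.encoding : Encoding PEABPInst Bool :=
  encodingNatBool.pairBool (RawBP.encoding.listBool.pairBool encodingNatBool)

/-- **Entropy Approximation for branching-program samplers**, `PEABP` (Shannon entropy, integer
thresholds, gap `1` — the convention of the tree's `PEA d`): on instances `(n, Bs, k)`, YES iff
`H(f(U_n)) ≥ k + 1`, NO iff `H(f(U_n)) ≤ k`, `f` the map sampled by the programs `Bs`.
[DGRV 2010, §3 p. 6 (`EA` / `PEA`) with the samplers of §4.2; AGMTW 2025, §2 (`EA_BP`)]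
[cite: DvirGutfreundRothblumVadhan2010, §4.2] -/
noncomputable def PEABP : PromiseProblem :=
  PromiseProblem.ofEncoding PEABPInst.encoding
    {I | (I.2.2 : ℝ) + 1 ≤ bpEntropy I.1 I.2.1}
    {I | bpEntropy I.1 I.2.1 ≤ (I.2.2 : ℝ)}

/-- Instances of `PEDBP`: two samplers `(n, Bs)`, `(n', Bs')`, each with its own number of
variables. [DGRV 2010, Def 3.1 (`ED`) with the samplers of §4.2] [cite: DvirGutfreundRothblumVadhan2010, §4.2] -/
abbrev PEDBPInst : Type := (ℕ × List RawBP) × (ℕ × List RawBP)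

/-- The Boolean code of `PEDBP` instances: the pair of the two sampler codes.
[Arora–Barak 2009, §0.1] [cite: AroraBarak2009, §0.1] -/
def PEDBPInst.encoding : Encoding PEDBPInst Bool :=
  (encodingNatBool.pairBool RawBP.encoding.listBool).pairBool
    (encodingNatBool.pairBool RawBP.encoding.listBool)

/-- **Entropy Difference for branching-program samplers**, `PEDBP` (Shannon entropy on both
sides, additive gap `1` — the convention of the tree's `PED d`): on pairs `(p, q)` of samplers,
YES iff `H(p(U)) ≥ H(q(U)) + 1`, NO iff `H(p(U)) + 1 ≤ H(q(U))`.  With logarithmic-space samplers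
this is the `SZKP_L`-complete problem of DGRV; a branching program per output bit is their
normal form of such a sampler. [DGRV 2010, Def 3.1, §4.2–4.3 (Thm 4.6–4.7); AGMTW 2025, §2 (`ED_BP`)]
[cite: DvirGutfreundRothblumVadhan2010, Thm 4.6] -/
noncomputable def PEDBP : PromiseProblem :=
  PromiseProblem.ofEncoding PEDBPInst.encoding
    {I | bpEntropy I.2.1 I.2.2 + 1 ≤ bpEntropy I.1.1 I.1.2}
    {I | bpEntropy I.1.1 I.1.2 + 1 ≤ bpEntropy I.2.1 I.2.2}

/-- Unfolding the yes-instances of `PEABP`: `k + 1 ≤ H`. [DGRV 2010, §3 p. 6] [cite: DvirGutfreundRothblumVadhan2010, §3 p.6] -/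
theorem encode_mem_PEABP_yes_iff (I : PEABPInst) :
    PEABPInst.encoding.encode I ∈ PEABP.yes ↔ (I.2.2 : ℝ) + 1 ≤ bpEntropy I.1 I.2.1 :=
  PEABPInst.encoding.mem_toLanguage_iff _ I

/-- Unfolding the no-instances of `PEABP`: `H ≤ k`. [DGRV 2010, §3 p. 6] [cite: DvirGutfreundRothblumVadhan2010, §3 p.6] -/
theorem encode_mem_PEABP_no_iff (I : PEABPInst) :
    PEABPInst.encoding.encode I ∈ PEABP.no ↔ bpEntropy I.1 I.2.1 ≤ (I.2.2 : ℝ) :=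
  PEABPInst.encoding.mem_toLanguage_iff _ I

/-- Unfolding the yes-instances of `PEDBP`: `H(q) + 1 ≤ H(p)`. [DGRV 2010, Def 3.1] [cite: DvirGutfreundRothblumVadhan2010, Def 3.1] -/
theorem encode_mem_PEDBP_yes_iff (I : PEDBPInst) :
    PEDBPInst.encoding.encode I ∈ PEDBP.yes ↔ bpEntropy I.2.1 I.2.2 + 1 ≤ bpEntropy I.1.1 I.1.2 :=
  PEDBPInst.encoding.mem_toLanguage_iff _ I

/-- Unfolding the no-instances of `PEDBP`: `H(p) + 1 ≤ H(q)`. [DGRV 2010, Def 3.1] [cite: DvirGutfreundRothblumVadhan2010, Def 3.1] -/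
theorem encode_mem_PEDBP_no_iff (I : PEDBPInst) :
    PEDBPInst.encoding.encode I ∈ PEDBP.no ↔ bpEntropy I.1.1 I.1.2 + 1 ≤ bpEntropy I.2.1 I.2.2 :=
  PEDBPInst.encoding.mem_toLanguage_iff _ I

/-- `PEABP` is a disjoint promise problem. [DGRV 2010, Def 3.1 ("do not intersect")] [cite: DvirGutfreundRothblumVadhan2010, Def 3.1] -/
theorem PEABP_disjoint : PEABP.Disjoint := by
  refine PromiseProblem.disjoint_ofEncoding _ (Set.disjoint_left.2 fun I hY hN => ?_)
  simp only [Set.mem_setOf_eq] at hY hN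
  linarith

/-- `PEDBP` is a disjoint promise problem. [DGRV 2010, Def 3.1] [cite: DvirGutfreundRothblumVadhan2010, Def 3.1] -/
theorem PEDBP_disjoint : PEDBP.Disjoint := by
  refine PromiseProblem.disjoint_ofEncoding _ (Set.disjoint_left.2 fun I hY hN => ?_)
  simp only [Set.mem_setOf_eq] at hY hN
  linarith

/-! ### The instance map to `PEA 3` (DGRV Thm 4.6, `PEA` side): semantics -/

namespace PEABPInst

/-- The number of random bits of the AIK encoding of the programs of an instance. [cite: ApplebaumIshaiKushilevitz2006, Lemma 4.15] -/
def fresh (I : PEABPInst) : ℕ := freshBDDs (compileAll I.1 I.2.1)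

/-- **The instance map `PEABP → PEA 3`**: `(n, Bs, k) ↦ (n + m, p̂, k + m)` where `p̂` is the
degree-3 perfect randomized encoding of the sampler with `m` random bits appended to the input.
[DGRV 2010, Thm 4.6 (proof) with Thm 4.5] [cite: DvirGutfreundRothblumVadhan2010, Thm 4.6] -/
def toPEA (I : PEABPInst) : PEAInst :=
  ⟨I.1 + I.fresh, (encodeBDDsMap I.1 (compileAll I.1 I.2.1), I.2.2 + I.fresh)⟩

/-- **Entropy bookkeeping**: the encoded map has entropy `H(f(U_n)) + m`.
[DGRV 2010, Claim 4.4] [cite: DvirGutfreundRothblumVadhan2010, Claim 4.4] -/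
theorem entropy_toPEA (I : PEABPInst) :
    (toPEA I).2.1.entropy = bpEntropy I.1 I.2.1 + I.fresh :=
  entropy_encodeBDDsMap I.1 (compileAll I.1 I.2.1)

/-- The encoded map has degree `≤ 3`. [DGRV 2010, Thm 4.5] [cite: DvirGutfreundRothblumVadhan2010, Thm 4.5] -/
theorem degLE_toPEA (I : PEABPInst) : (toPEA I).2.1.DegLE 3 :=
  degLE_three_encodeBDDsMap I.1 _

/-- **YES ↦ YES**: a yes-instance of `PEABP` is sent to a yes-instance of `PEA 3`.
[DGRV 2010, Thm 4.6] [cite: DvirGutfreundRothblumVadhan2010, Thm 4.6] -/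
theorem toPEA_mem_yes {I : PEABPInst} (hI : PEABPInst.encoding.encode I ∈ PEABP.yes) :
    PEAInst.encoding.encode (toPEA I) ∈ (PEA 3).yes := by
  rw [encode_mem_PEABP_yes_iff] at hI
  rw [encode_mem_PEA_yes_iff]
  refine ⟨degLE_toPEA I, ?_⟩
  rw [entropy_toPEA]
  change (((I.2.2 + I.fresh : ℕ) : ℝ)) + 1 ≤ bpEntropy I.1 I.2.1 + I.fresh
  push_cast
  linarith

/-- **NO ↦ NO**: a no-instance of `PEABP` is sent to a no-instance of `PEA 3`.
[DGRV 2010, Thm 4.6] [cite: DvirGutfreundRothblumVadhan2010, Thm 4.6] -/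
theorem toPEA_mem_no {I : PEABPInst} (hI : PEABPInst.encoding.encode I ∈ PEABP.no) :
    PEAInst.encoding.encode (toPEA I) ∈ (PEA 3).no := by
  rw [encode_mem_PEABP_no_iff] at hI
  rw [encode_mem_PEA_no_iff]
  refine ⟨degLE_toPEA I, ?_⟩
  rw [entropy_toPEA]
  change bpEntropy I.1 I.2.1 + I.fresh ≤ (((I.2.2 + I.fresh : ℕ) : ℝ))
  push_cast
  linarith

end PEABPInst

/-! ### A worked instance (non-vacuity): the program of `x₀ ∧ x₁` -/

/-- The raw 4-node program of `x₀ ∧ x₁` over `2` variables: nodes `0: sink 0`, `1: sink 1`,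
`2: test x₁ (lo 0, hi 1)`, `3 (root): test x₀ (lo 0, hi 2)`. [folklore] -/
def andRaw : RawBP := [(0, 0, 0, 0), (1, 0, 0, 0), (2, 1, 0, 1), (2, 0, 0, 2)]

/-- `andRaw` is valid over `2` variables. [folklore] -/
theorem andRaw_valid : RawBP.Valid 2 andRaw := by decide

/-- `andRaw` computes `x₀ ∧ x₁`. [folklore] -/
theorem andRaw_fn (z : Fin 2 → Bool) :
    (RawBP.compile 2 andRaw).2.fn z = (z 0 && z 1) := by
  rw [RawBP.compile_of_valid andRaw_valid]
  set B := RawBP.toBDD 2 andRaw andRaw_valid with hB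
  have e3 : B.node ⟨3, by decide⟩ = .branch 0 ⟨0, by decide⟩ ⟨2, by decide⟩ := by decide
  have e2 : B.node ⟨2, by decide⟩ = .branch 1 ⟨0, by decide⟩ ⟨1, by decide⟩ := by decide
  have e1 : B.node ⟨1, by decide⟩ = .leaf true := by decide
  have e0 : B.node ⟨0, by decide⟩ = .leaf false := by decide
  have h3 := BDD.eval_of_branch (z := z) e3
  have h2 := BDD.eval_of_branch (z := z) e2
  have h1 := BDD.eval_of_leaf (z := z) e1
  have h0 := BDD.eval_of_leaf (z := z) e0
  change B.eval z B.root = _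
  rw [show B.root = ⟨3, by decide⟩ from rfl, h3, h2, h1, h0]
  cases z 0 <;> cases z 1 <;> rfl

end Literature.Computability.Complexity
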